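import Summits.KontsevichZagierPeriods.KontsevichZagierPeriods.Theses.FurushoPentagon
import Literature.NumberTheory.Transcendental.KZRulesAssociator
import Literature.NumberTheory.Transcendental.KZCalculusProofs

/-!
# `ReducedPeriodRing` (stmt-KontsevichZagierPeriods-3929) — load-bearing analysis (negative side)

The crux `∀ c, c * c ∈ KZ.relations → c ∈ KZ.relations` has a single hypothesis; dropping it is
false (`[pt, 1] ∉ relations`), and the on-the-nose strengthening `c * c ∈ relations → c = 0` is
false (`[∅] ∈ relations`, `[∅] ≠ 0`). Over the abstract interface (commutative ring + evaluation
character) nilpotents are consistent (dual numbers), so no structural argument alone proves the crux.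
[Kontsevich–Zagier 2001, §1.2, §4.1]
-/

namespace Summit.KontsevichZagierPeriods.KontsevichZagierPeriods.ReducedPeriodRingNegative

open Literature.NumberTheory.Transcendental KZ
open Summit.KontsevichZagierPeriods.KontsevichZagierPeriods.Theses.FurushoPentagon

/-- Any proof of `ReducedPeriodRing` must use its hypothesis: `relations ≠ ⊤` since `[pt, 1]`
evaluates to `1` (soundness `KZ.relations_le_ker_eval_holds`). [folklore] -/
theorem reducedPeriodRing_false_without_sq : ¬ ∀ c : FormalRep, c ∈ relations := by
  intro h
  have h0 : eval (of IntegralRep.unit) = 0 := relations_le_ker_eval_holds (h _)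
  rw [eval_of, IntegralRep.value_unit] at h0
  exact one_ne_zero h0

/-- The on-the-nose strengthening of `ReducedPeriodRing` is false: `[∅] ∈ relations` (hence its
square too, `relations` being an ideal) but `[∅] ≠ 0` in the free abelian group. [folklore] -/
theorem not_reducedOnTheNose : ¬ ∀ c : FormalRep, c * c ∈ relations → c = 0 := by
  intro h
  have hmem : of (IntegralRep.empty 0) ∈ relations := IntegralRep.of_empty_mem_relations
  exact FreeAbelianGroup.of_ne_zero _ (h _ (mul_mem_relations_right_holds _ _ hmem))

/-- Nilpotents are consistent with everything the tree knows abstractly about `(P, eval)`: a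
commutative ring with a surjective evaluation character, cancellation by elements of non-zero
value, and yet a non-zero square-zero element — the dual numbers. [folklore] -/
theorem abstract_interface_admits_nilpotents :
    ∃ (R : Type) (_ : CommRing R) (ev : R →+* ℚ), Function.Surjective ev ∧
      (∀ x : R, ev x ≠ 0 → ∀ y : R, x * y = 0 → y = 0) ∧ ¬ IsReduced R := by
  refine ⟨DualNumber ℚ, inferInstance, (TrivSqZeroExt.fstHom ℚ ℚ ℚ).toRingHom, ?_, ?_, ?_⟩
  · intro q
    exact ⟨TrivSqZeroExt.inl q, by simp⟩
  · intro x hx y hxy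
    have hu : IsUnit x := by
      rw [TrivSqZeroExt.isUnit_iff_isUnit_fst, isUnit_iff_ne_zero]
      simpa using hx
    exact (hu.mul_right_eq_zero).mp hxy
  · intro hred
    have hnil : IsNilpotent (DualNumber.eps : DualNumber ℚ) :=
      ⟨2, by rw [pow_two]; exact DualNumber.eps_mul_eps⟩
    have h0 := hred.eq_zero _ hnil
    have := congrArg TrivSqZeroExt.snd h0
    simp at this

end Summit.KontsevichZagierPeriods.KontsevichZagierPeriods.ReducedPeriodRingNegative
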